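import Literature.NumberTheory.EllipticCurves.ZpExtensionScalarTwistFiniteProofs
import Mathlib.Algebra.Module.ZMod
import HarnessLib

/-!
# The residual representation of Howard's Eisenstein twist: `T_𝔮/𝔪 T_𝔮 = E[p] ⊗ S_𝔮/𝔪` with TRIVIAL action on
# the second factor (proofs file)

Topic `NumberTheory/EllipticCurves`; companion of `ZpExtensionScalarTwist` (the carrier
`EisensteinCoeff.Twisted p m k M = A_{m,k} ⊗_ℤ M`, `A_{m,k} = Λ/(T^m + p, p^k)`, with the twisted action
`ZpExtension.eisensteinTwist`: `σ · (c ⊗ a) = ((1+T)^{κ(σ)} c) ⊗ ρ(σ) a`). THEOREMS ONLY; no definition, no named fact,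
no instance, no `sorry` (D-0014/D-0026).

Howard, Compositio 140 (2004), proof of Prop. 2.1.3 (arXiv 3.1.3): «observe that `T̄_𝔭 ≅ E[p] ⊗ S_𝔭/𝔪`. The action
of `G_K` on `S_𝔭/𝔪` factors through `G_K → Λ/(p, γ−1) → S_𝔭/𝔪`, and so is trivial on the second factor of the tensor
product» — the sentence that discharges H.1, H.2 and H.5 of Thm. 1.6.1 for the specialised triple from the
corresponding facts about `E[p]`, and (x10b-p2 LEAD, 2026-08-28) the inclusion `L_s(T_𝔮) ⊆ L_1(T_pE) = L_E` of
Kolyvagin-prime sets. This file proves it on the tree's finite-level carrier, for the maximal ideal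
`𝔪 = (T̄) = (π)` of `A_{m,k}` (`m, k ≥ 1`):

* §1 the ideal `([T]) ⊂ A_{m,k}`: `[p] ∈ ([T])` (`[p] = −[T]^m`), `(1+T)^e − 1 ∈ ([T])`, and the residue character
  `A_{m,k} → 𝔽_p`, `[F] ↦ F(0) mod p` (as an `∃`: `exists_ringHom_zmod`), with kernel `([T])`;
* §2 `eisensteinTwist_sub_coeffExtension_mem` — **the twist is trivial modulo `([T])`**:
  `σ · x − (1 ⊗ ρ(σ)) x ∈ ([T]) • (A_{m,k} ⊗ M)`;
* §3 `exists_residualReduction` — for any «reduction datum» `r : M →+ N` (surjective, `ker r = pM`, equivariant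
  for `ρ`, `ρN`, with `p N = 0`; e.g. `E[p^k] → E[p]`, `P ↦ p^{k−1} P`) there is an additive SURJECTION
  `red : A_{m,k} ⊗ M → N`, `red (c ⊗ a) = (c(0) mod p) · r a`, with **`ker red = ([T]) • (A_{m,k} ⊗ M)`** and
  **`red (σ · x) = ρN(σ) (red x)`** for the TWISTED action on the source and the UNTWISTED one on the target —
  i.e. `T_𝔮/𝔪T_𝔮 ≅ T̄ = N` as Galois modules;
* §4 `apply_residual_eq_self_of_forall_sub_mem` — if `σ` acts trivially on `A_{m,k} ⊗ M` modulo an ideal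
  `I ≤ ([T])` (Howard's `I_ℓ ⊆ p^k`: «`Frob_λ` acts trivially on `T/I_ℓ T`»), then `σ` acts trivially on `N`
  (`= E[p]`): the kernel step of `L_s(T_𝔮) ⊆ L_E`.

Cell `pub/bsd-print-x9`, seat `bsd-line-x9-p1-w2` (g5), for v9-plan STUB 1 (H.1/H.5 transport, `L_s ⊆ L_E`) of the
shared μ-item on crux stmt-BirchSwinnertonDyer-27077 (x9-p1 LEAD g3, `HOME/p1/SKELETON-v9-PLAN.md`).

References: [Howard2004HeegnerKolyvagin] §2.2–2.3 (H.1, H.5, `L_k(T)`, Def. 2.2.1) and proof of Prop. 2.1.3 / Thm.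
2.2.10 (𝔮 = T^m + p); [Washington1997] §7.1, §13.2 (Λ/(p, T) = 𝔽_p).
-/

noncomputable section

open scoped TensorProduct

universe u v w

namespace Literature.NumberTheory.EllipticCurves

namespace IwasawaAlgebra.EisensteinCoeff

variable (p : ℕ) [hp : Fact p.Prime]

/-! ## §1 The ideal `([T])` of `A_{m,k}` and the residue character `A_{m,k} → 𝔽_p` -/

/-- In `A_{m,k}` (`m ≥ 1`): `[p] = −[T]^m`, hence **`[p] ∈ ([T])`** — the maximal ideal `(π, p)` of
`S_𝔮/p^k` is `(π)`. [cite: Howard2004HeegnerKolyvagin, §2.2 and proof of Thm. 2.2.10 (𝔮 = T^m + p)] [cite: Washington1997, §7.1] -/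
theorem natCast_mem_span_mk_X {m : ℕ} (hm : 1 ≤ m) (k : ℕ) :
    (p : EisensteinCoeff p m k) ∈ Ideal.span {(Ideal.Quotient.mk _ PowerSeries.X : EisensteinCoeff p m k)} := by
  set I : Ideal (IwasawaAlgebra p) :=
    Ideal.span {(PowerSeries.X ^ m + PowerSeries.C (p : ℤ_[p]) : IwasawaAlgebra p)} ⊔
      Ideal.span {PowerSeries.C ((p : ℤ_[p]) ^ k)} with hI
  have hq : Ideal.Quotient.mk I (PowerSeries.X ^ m + PowerSeries.C (p : ℤ_[p]) : IwasawaAlgebra p) = 0 :=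
    Ideal.Quotient.eq_zero_iff_mem.mpr (Ideal.mem_sup_left (Ideal.mem_span_singleton_self _))
  have h1 : Ideal.Quotient.mk I (PowerSeries.C (p : ℤ_[p])) = (p : IwasawaAlgebra p ⧸ I) := by
    rw [map_natCast, map_natCast]
  rw [map_add, map_pow, h1] at hq
  rw [eq_neg_of_add_eq_zero_right hq]
  exact Submodule.neg_mem _ (Ideal.pow_mem_of_mem _ (Ideal.mem_span_singleton_self _) m hm)

/-- `(1 + T) − 1 = [T] ∈ ([T])`. [cite: Howard2004HeegnerKolyvagin, §2.2] -/
theorem onePlusT_sub_one_mem_span_mk_X (m k : ℕ) :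
    onePlusT p m k - 1 ∈ Ideal.span {(Ideal.Quotient.mk _ PowerSeries.X : EisensteinCoeff p m k)} := by
  set I : Ideal (IwasawaAlgebra p) :=
    Ideal.span {(PowerSeries.X ^ m + PowerSeries.C (p : ℤ_[p]) : IwasawaAlgebra p)} ⊔
      Ideal.span {PowerSeries.C ((p : ℤ_[p]) ^ k)} with hI
  have h : onePlusT p m k - 1 = Ideal.Quotient.mk I PowerSeries.X := by
    rw [onePlusT_def, map_add, map_one, add_sub_cancel_left]
  rw [h]
  exact Ideal.mem_span_singleton_self _

/-- **`ψ` is valued in `1 + 𝔪`**: `(1+T)^e − 1 ∈ ([T])` for every exponent `e` (`u ≡ 1 ⇒ u^e ≡ 1`).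
[cite: Howard2004HeegnerKolyvagin, proof of Prop. 2.1.3 (the action on S_𝔭/𝔪 is trivial)] -/
theorem onePlusT_pow_sub_one_mem_span_mk_X (m k e : ℕ) :
    onePlusT p m k ^ e - 1 ∈ Ideal.span {(Ideal.Quotient.mk _ PowerSeries.X : EisensteinCoeff p m k)} := by
  induction e with
  | zero => rw [pow_zero, sub_self]; exact Ideal.zero_mem _
  | succ e ih =>
    have h : onePlusT p m k ^ (e + 1) - 1 =
        onePlusT p m k * (onePlusT p m k ^ e - 1) + (onePlusT p m k - 1) := by ring
    rw [h]
    exact Ideal.add_mem _ (Ideal.mul_mem_left _ _ ih) (onePlusT_sub_one_mem_span_mk_X p m k)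

/-- **The residue character `A_{m,k} → 𝔽_p`, `[F] ↦ F(0) mod p`** (`m, k ≥ 1`): the composite
`Λ → ℤ_p → ℤ/p` (constant coefficient, then reduction) kills `T^m + p` and `p^k`, so it factors through
`A_{m,k}`; it is a surjective ring homomorphism killing `[T]` and sending `1 + T` to `1`, and its kernel is
EXACTLY `([T])` (a class `[F]` with `F(0) ∈ pℤ_p` is `[T·G] + [p]·[b] ∈ ([T])`). So `A_{m,k}/([T]) = 𝔽_p` and
`([T])` is the maximal ideal. Stated as an existence (no new definition). [cite: Washington1997, §7.1 (Λ/(p,T) = 𝔽_p)]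
[cite: Howard2004HeegnerKolyvagin, proof of Prop. 2.1.3] -/
theorem exists_ringHom_zmod {m k : ℕ} (hm : 1 ≤ m) (hk : 1 ≤ k) :
    ∃ ε : EisensteinCoeff p m k →+* ZMod p,
      (∀ F : IwasawaAlgebra p, ε (Ideal.Quotient.mk _ F) = PadicInt.toZMod (PowerSeries.constantCoeff F)) ∧
      Function.Surjective ε ∧
      RingHom.ker ε = Ideal.span {(Ideal.Quotient.mk _ PowerSeries.X : EisensteinCoeff p m k)} ∧
      ε (onePlusT p m k) = 1 := by
  set I : Ideal (IwasawaAlgebra p) :=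
    Ideal.span {(PowerSeries.X ^ m + PowerSeries.C (p : ℤ_[p]) : IwasawaAlgebra p)} ⊔
      Ideal.span {PowerSeries.C ((p : ℤ_[p]) ^ k)} with hI
  let f : IwasawaAlgebra p →+* ZMod p := (PadicInt.toZMod (p := p)).comp PowerSeries.constantCoeff
  have hf : ∀ F : IwasawaAlgebra p, f F = PadicInt.toZMod (PowerSeries.constantCoeff F) := fun _ ↦ rfl
  have hfp : f (PowerSeries.C (p : ℤ_[p])) = 0 := by
    rw [hf, PowerSeries.constantCoeff_C, map_natCast, ZMod.natCast_self]
  have hle : I ≤ RingHom.ker f := by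
    refine sup_le ?_ ?_
    · rw [Ideal.span_le, Set.singleton_subset_iff, SetLike.mem_coe, RingHom.mem_ker, map_add, map_pow,
        hfp, hf, PowerSeries.constantCoeff_X, map_zero, zero_pow (by omega), zero_add]
    · rw [Ideal.span_le, Set.singleton_subset_iff, SetLike.mem_coe, RingHom.mem_ker,
        map_pow (PowerSeries.C (R := ℤ_[p])), map_pow f, hfp, zero_pow (by omega)]
  let ε : (IwasawaAlgebra p ⧸ I) →+* ZMod p := Ideal.Quotient.lift I f fun a ha ↦ hle ha
  have hε : ∀ F : IwasawaAlgebra p, ε (Ideal.Quotient.mk I F) = PadicInt.toZMod (PowerSeries.constantCoeff F) :=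
    fun F ↦ Ideal.Quotient.lift_mk I f _
  have hεX : ε (Ideal.Quotient.mk I PowerSeries.X) = 0 := by
    rw [hε, PowerSeries.constantCoeff_X, map_zero]
  have h1 : Ideal.Quotient.mk I (PowerSeries.C (p : ℤ_[p])) = (p : IwasawaAlgebra p ⧸ I) := by
    rw [map_natCast, map_natCast]
  refine ⟨ε, hε, ?_, ?_, ?_⟩
  · intro x
    refine ⟨Ideal.Quotient.mk I (PowerSeries.C ((x.val : ℤ) : ℤ_[p])), ?_⟩
    rw [hε, PowerSeries.constantCoeff_C, map_intCast, Int.cast_natCast, ZMod.natCast_zmod_val]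
  · apply le_antisymm
    · intro a ha
      obtain ⟨F, rfl⟩ := Ideal.Quotient.mk_surjective a
      rw [RingHom.mem_ker, hε] at ha
      -- `F(0) = p·b` and `F = X·G + C(F 0)`
      have hdvd : (p : ℤ_[p]) ∣ PowerSeries.constantCoeff F := by
        have hker : PowerSeries.constantCoeff F ∈ RingHom.ker (PadicInt.toZMod (p := p)) := ha
        rw [PadicInt.ker_toZMod, PadicInt.maximalIdeal_eq_span_p, Ideal.mem_span_singleton] at hker
        exact hker
      obtain ⟨b, hb⟩ := hdvd
      obtain ⟨G, hG⟩ : PowerSeries.X ∣ F - PowerSeries.C (PowerSeries.constantCoeff F) := by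
        rw [PowerSeries.X_dvd_iff, map_sub, PowerSeries.constantCoeff_C, sub_self]
      have hF : F = PowerSeries.X * G + PowerSeries.C (p : ℤ_[p]) * PowerSeries.C b := by
        rw [← map_mul, ← hb]; linear_combination hG
      rw [hF, map_add, map_mul, map_mul, h1]
      exact Ideal.add_mem _ (Ideal.mul_mem_right _ _ (Ideal.mem_span_singleton_self _))
        (Ideal.mul_mem_right _ _ (natCast_mem_span_mk_X p hm k))
    · rw [Ideal.span_le, Set.singleton_subset_iff, SetLike.mem_coe, RingHom.mem_ker]
      exact hεX
  · rw [onePlusT_def, map_add, map_one, map_add, map_one, hεX, add_zero]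

end IwasawaAlgebra.EisensteinCoeff

/-! ## §2 The twist is trivial modulo `([T])` -/

namespace ZpExtension

open Literature.NumberTheory.GaloisRepresentations Field

variable {K : Type u} [Field K] {p : ℕ} [hp : Fact p.Prime] (κ : ZpExtension K p)
  {M : Type w} [AddCommGroup M] [TopologicalSpace M] [DiscreteTopology M]
  (ρ : DiscreteGaloisModule K M) {m : ℕ} (hm : 1 ≤ m) (k : ℕ)

/-- **The Eisenstein twist is trivial modulo `𝔪 = ([T])`**: for every `σ ∈ Γ_K` and `x ∈ A_{m,k} ⊗ M`,
`σ · x − (1 ⊗ ρ(σ)) x = ((1+T)^{κ(σ)} − 1) • (1 ⊗ ρ(σ)) x ∈ ([T]) • (A_{m,k} ⊗ M)` — Howard: «the action of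
`G_K` on `S_𝔭/𝔪` … is trivial». [cite: Howard2004HeegnerKolyvagin, proof of Prop. 2.1.3 (T̄_𝔭 ≅ E[p] ⊗ S_𝔭/𝔪)] -/
theorem eisensteinTwist_apply_sub_coeffExtension_apply_mem (σ : absoluteGaloisGroup K)
    (x : IwasawaAlgebra.EisensteinCoeff.Twisted p m k M) :
    κ.eisensteinTwist ρ hm k σ x -
        DiscreteGaloisModule.coeffExtension (IwasawaAlgebra.EisensteinCoeff p m k) ρ σ x ∈
      (Ideal.span {(Ideal.Quotient.mk _ PowerSeries.X : IwasawaAlgebra.EisensteinCoeff p m k)} •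
        (⊤ : Submodule (IwasawaAlgebra.EisensteinCoeff p m k) (IwasawaAlgebra.EisensteinCoeff.Twisted p m k M))) := by
  rw [eisensteinTwist_apply_apply]
  have h : IwasawaAlgebra.EisensteinCoeff.onePlusT p m k ^ κ.twistExponent (eisensteinLevel (p := p) hm k) σ •
        DiscreteGaloisModule.coeffExtension (IwasawaAlgebra.EisensteinCoeff p m k) ρ σ x -
      DiscreteGaloisModule.coeffExtension (IwasawaAlgebra.EisensteinCoeff p m k) ρ σ x =
      (IwasawaAlgebra.EisensteinCoeff.onePlusT p m k ^ κ.twistExponent (eisensteinLevel (p := p) hm k) σ - 1) •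
        DiscreteGaloisModule.coeffExtension (IwasawaAlgebra.EisensteinCoeff p m k) ρ σ x := by
    rw [sub_smul, one_smul]
  rw [h]
  exact Submodule.smul_mem_smul (IwasawaAlgebra.EisensteinCoeff.onePlusT_pow_sub_one_mem_span_mk_X p m k _)
    Submodule.mem_top

/-! ## §3 The residual reduction `A_{m,k} ⊗ M ↠ N` (`N = M/pM`, e.g. `E[p^k] ↠ E[p]`) -/

/-- **The residual representation of the Eisenstein twist.** Let `m, k ≥ 1`, `ρ` a discrete `Γ_K`-module on `M`
and `r : M → N` a «reduction datum»: an additive surjection onto a discrete `Γ_K`-module `N` killed by `p`, with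
kernel `pM`, intertwining `ρ` and `ρN` (for `M = E[p^k]`, `N = E[p]`: `P ↦ p^{k−1} P`). Then there is an additive
SURJECTION `red : A_{m,k} ⊗ M → N` with `red (1 ⊗ a) = r a`, `red ([F] ⊗ a) = (F(0) mod p) · r a`, whose kernel is
EXACTLY `([T]) • (A_{m,k} ⊗ M)` and which intertwines Howard's TWISTED action `eisensteinTwist` on the source with the
UNTWISTED action `ρN` on the target: `red (σ · x) = ρN(σ) (red x)`. In Howard's words, `T̄_𝔮 = T_𝔮/𝔪 T_𝔮 ≅ E[p] ⊗ S_𝔮/𝔪`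
with `G_K` acting trivially on the second factor — the input of H.1, H.2, H.5 for the specialised triple.
[cite: Howard2004HeegnerKolyvagin, proof of Prop. 2.1.3 (T̄_𝔭 ≅ E[p] ⊗ S_𝔭/𝔪) and §2.3 (H.1, H.5)] [cite: Washington1997, §7.1] -/
theorem exists_residualReduction (hk : 1 ≤ k) {N : Type*} [AddCommGroup N] [TopologicalSpace N]
    [DiscreteTopology N] (ρN : DiscreteGaloisModule K N) (r : M →+ N) (hr : Function.Surjective r)
    (hrker : ∀ a : M, r a = 0 ↔ ∃ b : M, a = p • b)
    (hrρ : ∀ (σ : absoluteGaloisGroup K) (a : M), r (ρ σ a) = ρN σ (r a)) (hN : ∀ n : N, p • n = 0) :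
    ∃ red : IwasawaAlgebra.EisensteinCoeff.Twisted p m k M →+ N,
      (∀ a : M, red (IwasawaAlgebra.EisensteinCoeff.Twisted.tmul 1 a) = r a) ∧
      (∀ (F : IwasawaAlgebra p) (a : M),
        red (IwasawaAlgebra.EisensteinCoeff.Twisted.tmul (Ideal.Quotient.mk _ F) a) =
          (PadicInt.toZMod (PowerSeries.constantCoeff F)).val • r a) ∧
      Function.Surjective red ∧
      red.ker = ((Ideal.span {(Ideal.Quotient.mk _ PowerSeries.X : IwasawaAlgebra.EisensteinCoeff p m k)} •
        (⊤ : Submodule (IwasawaAlgebra.EisensteinCoeff p m k)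
          (IwasawaAlgebra.EisensteinCoeff.Twisted p m k M))).toAddSubgroup) ∧
      ∀ (σ : absoluteGaloisGroup K) (x : IwasawaAlgebra.EisensteinCoeff.Twisted p m k M),
        red (κ.eisensteinTwist ρ hm k σ x) = ρN σ (red x) := by
  classical
  haveI : Fact (1 < p) := ⟨hp.out.one_lt⟩
  obtain ⟨ε, hε, -, hεker, hεu⟩ := IwasawaAlgebra.EisensteinCoeff.exists_ringHom_zmod p hm hk
  have hεX : ε (Ideal.Quotient.mk _ PowerSeries.X) = 0 := by
    rw [← RingHom.mem_ker, hεker]; exact Ideal.mem_span_singleton_self _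
  have hε1 : ε 1 = 1 := map_one ε
  -- the `ℤ/p`-module structure on `N` and the bilinear map `(c, a) ↦ ε(c) • r a`
  letI : Module (ZMod p) N := AddCommGroup.zmodModule hN
  have hsmul : ∀ (c : ZMod p) (n : N), c • n = c.val • n := fun c n ↦ by
    conv_lhs => rw [← ZMod.natCast_zmod_val c]
    exact Nat.cast_smul_eq_nsmul _ _ _
  let B : IwasawaAlgebra.EisensteinCoeff p m k →ₗ[ℤ] M →ₗ[ℤ] N :=
    LinearMap.mk₂ ℤ (fun c a ↦ ε c • r a)
      (fun c c' a ↦ by rw [map_add, add_smul])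
      (fun n c a ↦ by rw [map_zsmul ε, smul_assoc])
      (fun c a a' ↦ by rw [map_add, smul_add])
      (fun n c a ↦ by rw [map_zsmul r, smul_comm])
  let red₀ : IwasawaAlgebra.EisensteinCoeff p m k ⊗[ℤ] M →ₗ[ℤ] N := TensorProduct.lift B
  let red : IwasawaAlgebra.EisensteinCoeff.Twisted p m k M →+ N := red₀.toAddMonoidHom
  have hred : ∀ (c : IwasawaAlgebra.EisensteinCoeff p m k) (a : M),
      red (IwasawaAlgebra.EisensteinCoeff.Twisted.tmul c a) = ε c • r a := fun c a ↦ by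
    have h : TensorProduct.lift B (c ⊗ₜ[ℤ] a) = B c a := TensorProduct.lift.tmul c a
    exact h
  -- `red` is `ε`-semilinear
  have hredsmul : ∀ (c : IwasawaAlgebra.EisensteinCoeff p m k) (x : IwasawaAlgebra.EisensteinCoeff.Twisted p m k M),
      red (c • x) = ε c • red x := fun c x ↦ by
    induction x using IwasawaAlgebra.EisensteinCoeff.Twisted.induction_on with
    | zero => rw [smul_zero, map_zero, smul_zero]
    | tmul c' a => rw [IwasawaAlgebra.EisensteinCoeff.Twisted.smul_tmul, hred, hred, map_mul, mul_smul]
    | add x y hx hy => rw [smul_add, map_add, map_add, hx, hy, smul_add]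
  have hred1 : ∀ a : M, red (IwasawaAlgebra.EisensteinCoeff.Twisted.tmul 1 a) = r a := fun a ↦ by
    rw [hred, hε1, one_smul]
  refine ⟨red, hred1, fun F a ↦ by rw [hred, hε, hsmul], fun n ↦ ?_, ?_, fun σ x ↦ ?_⟩
  · -- surjective
    obtain ⟨a, rfl⟩ := hr n
    exact ⟨_, hred1 a⟩
  · -- kernel
    set P : Submodule (IwasawaAlgebra.EisensteinCoeff p m k) (IwasawaAlgebra.EisensteinCoeff.Twisted p m k M) :=
      Ideal.span {(Ideal.Quotient.mk _ PowerSeries.X : IwasawaAlgebra.EisensteinCoeff p m k)} • ⊤ with hP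
    apply le_antisymm
    · -- `⊆`: a section `g : N → (A ⊗ M)/P` of `red` modulo `P`, `g (r a) = [1 ⊗ a]`
      intro x hx
      rw [AddMonoidHom.mem_ker] at hx
      rw [Submodule.mem_toAddSubgroup]
      let ι₁ : M →+ IwasawaAlgebra.EisensteinCoeff.Twisted p m k M :=
        AddMonoidHom.mk' (fun a ↦ IwasawaAlgebra.EisensteinCoeff.Twisted.tmul 1 a)
          (IwasawaAlgebra.EisensteinCoeff.Twisted.tmul_add 1)
      let φ : M →+ (IwasawaAlgebra.EisensteinCoeff.Twisted p m k M ⧸ P) := P.mkQ.toAddMonoidHom.comp ι₁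
      have hφ : ∀ a : M, φ a = P.mkQ (IwasawaAlgebra.EisensteinCoeff.Twisted.tmul 1 a) := fun _ ↦ rfl
      have hnat : ∀ (n : ℕ) (a : M), (IwasawaAlgebra.EisensteinCoeff.Twisted.tmul 1 (n • a) :
          IwasawaAlgebra.EisensteinCoeff.Twisted p m k M) =
            (n : IwasawaAlgebra.EisensteinCoeff p m k) • IwasawaAlgebra.EisensteinCoeff.Twisted.tmul 1 a :=
        fun n a ↦ by
          rw [IwasawaAlgebra.EisensteinCoeff.Twisted.tmul_nsmul, Nat.cast_smul_eq_nsmul]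
      have hkerφ : r.ker ≤ φ.ker := by
        intro a ha
        rw [AddMonoidHom.mem_ker] at ha ⊢
        obtain ⟨b, rfl⟩ := (hrker a).mp ha
        rw [hφ, hnat, Submodule.mkQ_apply, Submodule.Quotient.mk_eq_zero]
        exact Submodule.smul_mem_smul (IwasawaAlgebra.EisensteinCoeff.natCast_mem_span_mk_X p hm k)
          Submodule.mem_top
      let g : N →+ (IwasawaAlgebra.EisensteinCoeff.Twisted p m k M ⧸ P) := r.liftOfSurjective hr ⟨φ, hkerφ⟩
      have hg : ∀ a : M, g (r a) = φ a := fun a ↦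
        r.liftOfRightInverse_comp_apply (Function.surjInv hr) (Function.rightInverse_surjInv hr) ⟨φ, hkerφ⟩ a
      have hsect : ∀ y : IwasawaAlgebra.EisensteinCoeff.Twisted p m k M, g (red y) = P.mkQ y := by
        intro y
        induction y using IwasawaAlgebra.EisensteinCoeff.Twisted.induction_on with
        | zero => rw [map_zero, map_zero, map_zero]
        | tmul c a =>
          rw [hred, hsmul, ← map_nsmul, hg, hφ, hnat, Submodule.mkQ_apply, Submodule.mkQ_apply,
            IwasawaAlgebra.EisensteinCoeff.Twisted.tmul_eq_smul_tmul_one c a, Submodule.Quotient.eq, ← sub_smul]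
          refine Submodule.smul_mem_smul ?_ Submodule.mem_top
          rw [← hεker, RingHom.mem_ker, map_sub, map_natCast, ZMod.natCast_zmod_val, sub_self]
        | add y z hy hz => rw [map_add, map_add, hy, hz, map_add]
      have hx' := hsect x
      rw [hx, map_zero, Submodule.mkQ_apply, eq_comm, Submodule.Quotient.mk_eq_zero] at hx'
      exact hx'
    · intro x hx
      rw [Submodule.mem_toAddSubgroup] at hx
      rw [AddMonoidHom.mem_ker]
      refine Submodule.smul_induction_on hx (fun c hc y _ ↦ ?_) (fun x y hx hy ↦ by rw [map_add, hx, hy, add_zero])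
      have hc0 : ε c = 0 := by rw [← RingHom.mem_ker, hεker]; exact hc
      rw [hredsmul, hc0, zero_smul]
  · -- equivariance
    induction x using IwasawaAlgebra.EisensteinCoeff.Twisted.induction_on with
    | zero => rw [map_zero, map_zero, map_zero]
    | tmul c a =>
      rw [eisensteinTwist_apply_tmul, hred, hred, map_mul, map_pow, hεu, one_pow, one_mul, hrρ, hsmul, hsmul,
        map_nsmul]
    | add x y hx hy => rw [map_add, map_add, hx, hy, map_add, map_add]

/-! ## §4 The kernel step of `L_s(T_𝔮) ⊆ L_E` -/

/-- **An element acting trivially on `T_𝔮/I T_𝔮` (`I ≤ 𝔪`) acts trivially on `T̄ = N`.** If `σ · x − x ∈ I • (A ⊗ M)`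
for every `x`, with `I ≤ ([T])` — Howard's «`Frob_λ` acts trivially on `T/I_ℓ T`» for `ℓ ∈ L_k(T_𝔮)`,
`I_ℓ ⊆ p^k S_𝔮 ⊆ 𝔪` (Def. 2.2.1) — then `ρN(σ) = id` on `N` (for `E`: `Frob_λ` is trivial on `E[p]`, i.e.
`ℓ ∈ L_1(T_pE) = L_E` once `p ∣ ℓ + 1`). [cite: Howard2004HeegnerKolyvagin, Def. 2.2.1 and proof of Prop. 2.1.3] -/
theorem apply_residual_eq_self_of_forall_sub_mem (hk : 1 ≤ k) {N : Type*} [AddCommGroup N]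
    [TopologicalSpace N] [DiscreteTopology N] (ρN : DiscreteGaloisModule K N) (r : M →+ N)
    (hr : Function.Surjective r) (hrker : ∀ a : M, r a = 0 ↔ ∃ b : M, a = p • b)
    (hrρ : ∀ (σ : absoluteGaloisGroup K) (a : M), r (ρ σ a) = ρN σ (r a)) (hN : ∀ n : N, p • n = 0)
    {I : Ideal (IwasawaAlgebra.EisensteinCoeff p m k)}
    (hI : I ≤ Ideal.span {(Ideal.Quotient.mk _ PowerSeries.X : IwasawaAlgebra.EisensteinCoeff p m k)})
    {σ : absoluteGaloisGroup K}
    (hσ : ∀ x : IwasawaAlgebra.EisensteinCoeff.Twisted p m k M,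
      κ.eisensteinTwist ρ hm k σ x - x ∈
        (I • (⊤ : Submodule (IwasawaAlgebra.EisensteinCoeff p m k)
          (IwasawaAlgebra.EisensteinCoeff.Twisted p m k M)))) (n : N) :
    ρN σ n = n := by
  obtain ⟨red, hred1, -, -, hker, hequiv⟩ := κ.exists_residualReduction ρ hm k hk ρN r hr hrker hrρ hN
  obtain ⟨a, rfl⟩ := hr n
  have hmem : κ.eisensteinTwist ρ hm k σ (IwasawaAlgebra.EisensteinCoeff.Twisted.tmul 1 a) -
      IwasawaAlgebra.EisensteinCoeff.Twisted.tmul 1 a ∈ red.ker := by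
    rw [hker, Submodule.mem_toAddSubgroup]
    exact Submodule.smul_mono_left hI (hσ _)
  rw [AddMonoidHom.mem_ker, map_sub, sub_eq_zero, hequiv, hred1] at hmem
  exact hmem

end ZpExtension

end Literature.NumberTheory.EllipticCurves

end
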